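/-
Copyright (c) 2026. All rights reserved.
Released under Apache 2.0 license as described in the file LICENSE.
Authors: abc-iut cell, statement-typer seat abc-iut-L4-t3 (wave 1; gen 6).
-/
import Literature.AnabelianGeometry.AbsoluteAnabelian.GaloisTheatersTrivialContext
import HarnessLib

/-!
# [AbsTopIII] Definition 5.1 (ii)/(iii), print-faithful successor: the functorial data `V⊚(−)`, `k_NF(−)` as functors on `EA⊚` (admissible objects ONLY)

S. Mochizuki, *Topics in absolute anabelian geometry III: global reconstruction algorithms*,
J. Math. Sci. Univ. Tokyo 22 (2015) 939–1156 [MochizukiAbsTopIII2015]; locators `p.N` = pages of the author's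
manuscript (`paper:url-5493eb38cbb7`), read on the page (own render): Def 5.1 (ii) p. 114 ("we shall write `EA⊚` for the
category whose objects are profinite groups isomorphic to `Π_X` for some `X` as above and whose morphisms are open
injections of profinite groups …"; "by considering valuations on the field `k_NF(Π_X)` … one may functorially construct
`V⊚(F̄/F)`, `V(F̄/F)` from `Π_X`"), Def 5.1 (iii) p. 115 (global Galois-theaters; morphisms of `EA⊚`).

WHY THIS FILE (successor, never in place; this seat's FROZEN `GaloisTheaters.lean` p405186 is NOT edited; L4-lead
RULING 2026-08-26T11:36:58Z on abc-iut-L4-d2's finding, COR52III-CONTEXT-CENSUS §6).  In the frozen interface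
`GlobalAnabelianContext` the functoriality fields `mapProVal`, `mapProVal_smul`, `mapKNF` are quantified over ALL
extensions `E₁`, `E₂` and all `IsEAHom f` — STRONGER than print, where `V⊚(−)` and `k_NF(−)` are functors on `EA⊚`, i.e.
on ADMISSIBLE objects only (`Ob(EA⊚)` = "profinite groups isomorphic to `Π_X` for some `X`").  abc-iut-L4-d2 showed the
over-quantification is load-bearing: it blocks the genuine `Δ = 1` shadow-context term, constructible under the
print-faithful binder.  Here:

* `AdmGlobalAnabelianContext` — the same fields VERBATIM, with the three functoriality fields binder-restricted to
  `IsAdmissible E₁ → IsAdmissible E₂ → IsEAHom f → …` (print's `EA⊚`);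
* `GlobalAnabelianContext.toAdm` — the forgetful bridge: every old-binder context IS a successor context (so the ≈20
  consumer files of `GlobalAnabelianContext` do not migrate; NEW constructions target the successor), with `rfl` lemmas;
* `AdmGlobalAnabelianContext.IsFunctorial` — OPTIONAL hypothesis schema (not asserted): "functorially construct" read
  strictly — `V⊚(−)`, `k_NF(−)` respect identities and composition on `EA⊚` (the law whose absence abc-iut-w5-d058 noted
  as interface note I-L4-t3-1); a `Prop`-valued structure a consumer may assume BY NAME;
* non-vacuity: `nonempty_admGlobalAnabelianContext` through `toAdm` of abc-iut-w5-d058's trivial-group context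
  (DEGENERATE witness: `Ob(EA⊚) := {Π = 1}`, `k_NF := ℚ`, `V⊚ := {⊚}` — consistency of the typing only).

Typed-scope hygiene on OUR interface; nothing here bears on [IUTchIII] Cor. 3.12; no side taken; typed ≠ proved.
-/

set_option autoImplicit false

universe u

open CategoryTheory Topology

namespace Literature.AnabelianGeometry.AbsoluteAnabelian

/-! ## The successor structure -/

/-- **Def 5.1 (ii) interface, print-faithful successor of `GlobalAnabelianContext`**: the data "functorially constructed
from `Π_X`" for `Π_X ∈ Ob(EA⊚)` — `Ob(EA⊚)` (`IsAdmissible`), the characterization of `Δ_X ⊆ Π_X`, `k_NF(Π)` with its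
`Π`-action, `V⊚(Π)`, the archimedean Aut-holomorphic orbispaces `X(Π, v)` with `δ_{ell,v}`, `κ_{ell,v}` — VERBATIM as in the
frozen interface, and the functoriality of `V⊚(−)`, `k_NF(−)` in morphisms of `EA⊚`, i.e. ONLY between ADMISSIBLE objects
(`IsAdmissible E₁`, `IsAdmissible E₂`) along open injections inducing `Δ₁ ≅ Δ₂` (`IsEAHom f`).
[cite: MochizukiAbsTopIII2015, Def 5.1 (ii) p. 114] -/
structure AdmGlobalAnabelianContext : Type (u + 1) where
  /-- `Ob(EA⊚)`: "profinite groups isomorphic to `Π_X` for some `X` as in (ii)" -/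
  IsAdmissible : FundamentalExtension.{u} → Prop
  /-- `Ob(EA⊚)` is isomorphism-closed -/
  isAdmissible_of_iso : ∀ {E₁ E₂ : FundamentalExtension.{u}}, Nonempty (E₁ ≅ E₂) →
    IsAdmissible E₁ → IsAdmissible E₂
  /-- "`Δ_X ⊆ Π_X` … may be characterized group-theoretically as the maximal topologically finitely
  generated closed normal subgroup" ([Mzk9] Lemma 1.1.4 (i)) -/
  geom_isMax : ∀ E, IsAdmissible E → IsMaxTopFGClosedNormal E.geom
  /-- `k_NF(Π)`: "one may functorially construct `F̄` from `Π_X` as the field `k^×_NF ∪ {0}` constructed in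
  Theorem 1.9 (e)" -/
  kNF : FundamentalExtension.{u} → Type u
  /-- `k_NF(Π)` is a field -/
  [instField : ∀ E, Field (kNF E)]
  /-- with its natural action of `Π` by field automorphisms -/
  [instAction : ∀ E, MulSemiringAction E.arith (kNF E)]
  /-- `V⊚(Π)` with its `Π`-action: "by considering valuations on the field `k_NF(Π_X)` one may functorially
  construct `V⊚(F̄/F)`, `V(F̄/F)` from `Π_X`" -/
  proVal : (E : FundamentalExtension.{u}) → GaloisProSet E.arith
  /-- `X(Π, v)` for archimedean `v`: the Aut-holomorphic orbispace `X_{ell,v}` of Cor 2.8 "regarded as an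
  object constructed from `Π_X`" -/
  archSpace : (E : FundamentalExtension.{u}) → (proVal E).arc → AutHolOrbispace.{u}
  /-- `δ_{ell,v} : Δ_X ≅ π₁(X_{ell,v})^∧`, "the natural outer isomorphism" (a representative) -/
  δell : (E : FundamentalExtension.{u}) → (v : (proVal E).arc) → E.geom ≃ₜ* (archSpace E v).pi1Hat
  /-- `κ_{ell,v} : k_NF(Π_X) ↪ A_{X_{ell,v}}`, "the natural inclusion of fields" (Cor 2.9 (b)) -/
  κell : (E : FundamentalExtension.{u}) → (v : (proVal E).arc) → kNF E →+* (archSpace E v).fieldA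
  /-- functoriality of `V⊚(−)` in morphisms of `EA⊚` — between ADMISSIBLE objects only -/
  mapProVal : ∀ {E₁ E₂ : FundamentalExtension.{u}} (f : E₁ ⟶ E₂), IsAdmissible E₁ → IsAdmissible E₂ → IsEAHom f →
    (proVal E₁).carrier ≃ₜ (proVal E₂).carrier
  /-- `V⊚(f)` is equivariant along `Π₁ ↪ Π₂` -/
  mapProVal_smul : ∀ {E₁ E₂ : FundamentalExtension.{u}} (f : E₁ ⟶ E₂) (h₁ : IsAdmissible E₁) (h₂ : IsAdmissible E₂)
    (hf : IsEAHom f) (g : E₁.arith) (v : (proVal E₁).carrier),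
    mapProVal f h₁ h₂ hf (g • v) = f.arith g • mapProVal f h₁ h₂ hf v
  /-- functoriality of `k_NF(−)` in morphisms of `EA⊚` (`k_NF(Π₁) ≅ k_NF(Π₂) ≅ F̄`) — between ADMISSIBLE objects only -/
  mapKNF : ∀ {E₁ E₂ : FundamentalExtension.{u}} (f : E₁ ⟶ E₂), IsAdmissible E₁ → IsAdmissible E₂ → IsEAHom f →
    kNF E₁ ≃+* kNF E₂

-- NOTE (typer lint): unlike the frozen parent, NO global `instance` attribute is registered for `instField` /
-- `instAction`; a consumer working in `R.kNF E` writes `letI := R.instField E` (the fields' own types carry the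
-- instances, so every field is usable as is).

/-! ## The forgetful bridge: every old-binder context is a successor context -/

/-- **The forgetful bridge** `GlobalAnabelianContext → AdmGlobalAnabelianContext`: restrict the three functoriality fields
to admissible objects (the frozen interface supplies them for all extensions).  Consumers of the frozen interface do not
migrate; new constructions target the successor. [cite: MochizukiAbsTopIII2015, Def 5.1 (ii) p. 114] -/
def GlobalAnabelianContext.toAdm (R : GlobalAnabelianContext.{u}) : AdmGlobalAnabelianContext.{u} where
  IsAdmissible := R.IsAdmissible
  isAdmissible_of_iso := R.isAdmissible_of_iso
  geom_isMax := R.geom_isMax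
  kNF := R.kNF
  proVal := R.proVal
  archSpace := R.archSpace
  δell := R.δell
  κell := R.κell
  mapProVal f _ _ hf := R.mapProVal f hf
  mapProVal_smul f _ _ hf := R.mapProVal_smul f hf
  mapKNF f _ _ hf := R.mapKNF f hf

namespace GlobalAnabelianContext

variable (R : GlobalAnabelianContext.{u})

/-- `toAdm` keeps `Ob(EA⊚)`. [cite: MochizukiAbsTopIII2015, Def 5.1 (ii) p. 114] -/
@[simp] theorem toAdm_isAdmissible (E : FundamentalExtension.{u}) : R.toAdm.IsAdmissible E = R.IsAdmissible E := rfl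

/-- `toAdm` keeps `k_NF(Π)`. [cite: MochizukiAbsTopIII2015, Def 5.1 (ii) p. 114] -/
@[simp] theorem toAdm_kNF (E : FundamentalExtension.{u}) : R.toAdm.kNF E = R.kNF E := rfl

/-- `toAdm` keeps `V⊚(Π)`. [cite: MochizukiAbsTopIII2015, Def 5.1 (ii) p. 114] -/
@[simp] theorem toAdm_proVal (E : FundamentalExtension.{u}) : R.toAdm.proVal E = R.proVal E := rfl

/-- `toAdm` restricts `V⊚(f)`. [cite: MochizukiAbsTopIII2015, Def 5.1 (ii) p. 114] -/
@[simp] theorem toAdm_mapProVal {E₁ E₂ : FundamentalExtension.{u}} (f : E₁ ⟶ E₂) (h₁ : R.IsAdmissible E₁)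
    (h₂ : R.IsAdmissible E₂) (hf : IsEAHom f) : R.toAdm.mapProVal f h₁ h₂ hf = R.mapProVal f hf := rfl

/-- `toAdm` restricts `k_NF(f)`. [cite: MochizukiAbsTopIII2015, Def 5.1 (ii) p. 114] -/
@[simp] theorem toAdm_mapKNF {E₁ E₂ : FundamentalExtension.{u}} (f : E₁ ⟶ E₂) (h₁ : R.IsAdmissible E₁)
    (h₂ : R.IsAdmissible E₂) (hf : IsEAHom f) : R.toAdm.mapKNF f h₁ h₂ hf = R.mapKNF f hf := rfl

end GlobalAnabelianContext

/-! ## "Functorially construct", strictly: the optional functoriality laws -/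

/-- **Hypothesis schema (not asserted): `V⊚(−)` and `k_NF(−)` are FUNCTORS on `EA⊚`** — they send the identity of an
admissible `Π` to the identity and composites of morphisms of `EA⊚` to composites (the strict reading of "functorially
construct", Def 5.1 (ii); the law interface note I-L4-t3-1 of abc-iut-w5-d058 found missing from the frozen interface).
A consumer needing it assumes `(hR : R.IsFunctorial)` BY NAME. [cite: MochizukiAbsTopIII2015, Def 5.1 (ii) p. 114] -/
structure AdmGlobalAnabelianContext.IsFunctorial (R : AdmGlobalAnabelianContext.{u}) : Prop where
  /-- `k_NF(id_Π) = id` (pointwise) -/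
  mapKNF_id : ∀ (E : FundamentalExtension.{u}) (h : R.IsAdmissible E) (hid : IsEAHom (𝟙 E)) (x : R.kNF E),
    R.mapKNF (𝟙 E) h h hid x = x
  /-- `k_NF(g ∘ f) = k_NF(g) ∘ k_NF(f)` (pointwise) -/
  mapKNF_comp : ∀ {E₁ E₂ E₃ : FundamentalExtension.{u}} (f : E₁ ⟶ E₂) (g : E₂ ⟶ E₃) (h₁ : R.IsAdmissible E₁)
    (h₂ : R.IsAdmissible E₂) (h₃ : R.IsAdmissible E₃) (hf : IsEAHom f) (hg : IsEAHom g) (hfg : IsEAHom (f ≫ g))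
    (x : R.kNF E₁), R.mapKNF (f ≫ g) h₁ h₃ hfg x = R.mapKNF g h₂ h₃ hg (R.mapKNF f h₁ h₂ hf x)
  /-- `V⊚(id_Π) = id` (pointwise) -/
  mapProVal_id : ∀ (E : FundamentalExtension.{u}) (h : R.IsAdmissible E) (hid : IsEAHom (𝟙 E))
    (v : (R.proVal E).carrier), R.mapProVal (𝟙 E) h h hid v = v
  /-- `V⊚(g ∘ f) = V⊚(g) ∘ V⊚(f)` (pointwise) -/
  mapProVal_comp : ∀ {E₁ E₂ E₃ : FundamentalExtension.{u}} (f : E₁ ⟶ E₂) (g : E₂ ⟶ E₃) (h₁ : R.IsAdmissible E₁)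
    (h₂ : R.IsAdmissible E₂) (h₃ : R.IsAdmissible E₃) (hf : IsEAHom f) (hg : IsEAHom g) (hfg : IsEAHom (f ≫ g))
    (v : (R.proVal E₁).carrier), R.mapProVal (f ≫ g) h₁ h₃ hfg v = R.mapProVal g h₂ h₃ hg (R.mapProVal f h₁ h₂ hf v)

/-! ## Non-vacuity -/

/-- **The successor interface is inhabited**, in every universe: `toAdm` of abc-iut-w5-d058's TRIVIAL-GROUP context
(`Ob(EA⊚) := {Π = 1}`, `k_NF := ℚ`, `V⊚(Π) := {⊚}`) — a DEGENERATE consistency witness, no arithmetic content.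
[cite: MochizukiAbsTopIII2015, Def 5.1 (ii) p. 114] -/
theorem nonempty_admGlobalAnabelianContext : Nonempty AdmGlobalAnabelianContext.{u} := by
  obtain ⟨R, -⟩ := GlobalAnabelianContext.exists_trivialGroupContext.{u}
  exact ⟨R.toAdm⟩

end Literature.AnabelianGeometry.AbsoluteAnabelian
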